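import Literature.NumberTheory.Sieve.FordAsymptoticSieveLemma22
import Literature.NumberTheory.Sieve.FordAsymptoticSieveTuples
import Literature.NumberTheory.Sieve.FordAsymptoticSieveExpAlgebra
import HarnessLib

/-!
# Ford's counterexamples to a fixed-level asymptotic sieve: the construction and (2.4)

Topic `Literature/NumberTheory/Sieve`, companion of `FordAsymptoticSieve.lean` (the named fact
`Literature.NumberTheory.Sieve.Ford2004_localConstruction` = [Ford2004] Theorem 3 with the choice
of `f_{1_M}` of the proof of Theorem 1). Source: K. Ford, *On Bombieri's asymptotic sieve*, Trans.
Amer. Math. Soc. **357** (2005) 1663–1674 (arXiv math/0401215) [Ford2004], §3: the construction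
`a_n = 1 + b_n` on `I = (x, x + xη]` and the proof that it satisfies (2.4)
((3.2)–(3.4) and (3.8)–(3.10)).

## The construction formalised (a specialisation of [Ford2004] §3)

Ford's `b_n = f_α(log p_1/log n, …, log p_r/log n)` for `n = p_1⋯p_r ∈ 𝒞_α` uses the
functions `f_α(v) = e_α v_1⋯v_r ∫ f_{1_M}(w)/∏ w_{ij}` ((3.5)) with `e_α = (−1)^{Σ(α)+|α|}/∏α_i`
((3.9)). For the PRODUCT choice `f_{1_M}(w) = ∏_i w_i Φ(w_i)` (`Φ` a bump around `1/M`,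
`Ford2004.Bump`) the fibre integrals factor: `f_α(v) = ∏_j c_{α_j} v_j Φ^{*α_j}(v_j)` with
`c_a = (−1)^{a+1}/a`, so that, with `G = ∑_{a=1}^{M} c_a Φ^{*a}` (`Bump.G`, "`log(1+Φ)`" in the
convolution algebra of `Literature.Analysis.Convolution.CompactlySupportedConvolutionAlgebra`) and
the prime weight `g(p) = t_p G(t_p)`, `t_p = log p/log x` (`Bump.wt`; we normalise by `log x`
rather than `log n`, immaterial on `I`), Ford's `b_n` summed over all `α ∈ P(M)` is
`B(n) = ∑_{s ⊆ primes, ∏ s = n} ∏_{p ∈ s} g(p)` (`Bump.Bfun`; `= μ²(n) ∏_{p∣n} g(p)`), and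
`|B(n)| ≤ 1` (`norm_Bfun_le`, so `a_n = 1 ± B(n) ∈ [0, 2]`, (2.3)).

## Main result: the Type-I estimate

* `Bump.typeI_bound` — (2.4) for the perturbation: for `1/M + w < ϖ`, `c₁ ≤ c√ε/4`, `x ≥ x₀`
  and `1 ≤ d ≤ x^{1−ϖ}`: `‖∑_{x < n ≤ x+xη, d ∣ n} B(n)‖ ≤ C_A (x/d) η²`.

Proof, following §3: split off the primes of `d` (`Tsum_eq`, the tree's
`Ford2004.sum_powerset_filter_dvd`; the coprimality constraint costs `O(|t₀|(yη/x^ε + 1))`,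
`norm_innerSum_sub_Ssum_le`), pass from sets of primes to ordered tuples
(`SsumH_eq_sum_primeSum_sub`: layers `r ≤ M` through `Ford2004.sum_filter_injective_eq`, the
non-injective tuples being few, `Ford2004.card_nonInj_le`; layers `r > M` vanish), evaluate the
tuple sums by Lemma 2.2 (`Ford2004.primeSum_est`), and watch the main terms
`(yη/log x) ∑_r (1/r!) G^{*r}(Y)` CANCEL (`mainTerm_eq_zero`): in the unitised convolution algebra
`∑_r (1/r!) G^r = exp(log(1+Φ)) − 1 + (degree > M) = Φ + junk`
(`Ford2004.apply_sum_pow_logCoeff_eq`, i.e. (3.8)–(3.10)), `Φ(Y) = 0` for `Y > 1/M + w`, and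
the junk vanishes at `Y ≤ 1` by the support band of `Φ^{*i}`, `i > M`. The generic part (any
weight `t_p H(t_p)`, `H ∈ C_c`: `wtH`, `SsumH`, `sum_piFinset_eq_primeSum`, `layer_eq`,
`norm_sum_nonInj_le`, `SsumH_eq_sum_primeSum_sub`) is reused for the `Λ_k`-sums.

Everything here is PROVED (definitions with bodies and theorems; no named facts).

## References

* K. Ford, *On Bombieri's asymptotic sieve*, Trans. AMS 357 (2005), 1663–1674, §3 [Ford2004].
-/

noncomputable section

open Finset Real MeasureTheory Literature.Analysis.Convolution
open scoped Chebyshev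

namespace Literature.NumberTheory.Sieve.Ford2004

/-! ### Prime weights `t_p H(t_p)` and subset sums, for a general `H ∈ C_c(ℝ)` -/

/-- The weight of a prime attached to `H`: `t_p H(t_p)`, `t_p = log p/log x`.
[cite: Ford2004, §3 (3.5)] -/
def wtH (H : ConvFun) (x : ℝ) (p : ℕ) : ℂ := (tOf x p : ℂ) * H (tOf x p)

/-- Members of `primesIn a b` are prime. [folklore] -/
theorem primesIn_prime {a b p : ℕ} (hp : p ∈ primesIn a b) : p.Prime := (mem_primesIn.mp hp).1

/-- The weight vanishes unless `x^ε ≤ p`, if `H` vanishes below `ε`. [folklore] -/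
theorem wtH_eq_zero_of_lt {H : ConvFun} {ε x : ℝ} (hH : ∀ t, H t ≠ 0 → ε ≤ t) (hx : 1 < x) {p : ℕ}
    (hp : (p : ℝ) < x ^ ε) : wtH H x p = 0 := by
  rw [wtH]
  rcases Nat.eq_zero_or_pos p with rfl | hp0
  · simp [tOf]
  · have ht : tOf x p < ε := by
      rw [tOf, div_lt_iff₀ (Real.log_pos hx)]
      have := Real.log_lt_log (by exact_mod_cast hp0) hp
      rwa [Real.log_rpow (by linarith)] at this
    have : H (tOf x p) = 0 := by
      by_contra hne; exact absurd (hH _ hne) (not_le.mpr ht)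
    rw [this, mul_zero]

/-- The window indicator `[y < m ≤ y(1+η)]`. [folklore] -/
def win (c₁ x y : ℝ) (m : ℝ) : Prop := y < m ∧ m ≤ y * (1 + eta c₁ x)

/-- The window condition is decidable. [folklore] -/
instance (c₁ x y m : ℝ) : Decidable (win c₁ x y m) := by unfold win; infer_instance

/-- `S_H(y) = ∑_{s ⊆ {p ≤ x²}} [y < ∏ s ≤ y(1+η)] ∏_{p ∈ s} t_p H(t_p)`. [folklore] -/
def SsumH (H : ConvFun) (c₁ x y : ℝ) : ℂ :=
  ∑ s ∈ (primesIn 0 ⌊x ^ 2⌋₊).powerset,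
    (if win c₁ x y (∏ p ∈ s, ((p : ℕ) : ℝ)) then ∏ p ∈ s, wtH H x p else 0)

/-- The sum over ALL ordered `r`-tuples of primes `≤ x²` of `[∏ u ∈ window] ∏ t_{u_i} H(t_{u_i})`
is `Σ_r(y)` (`primeSum`). [folklore] -/
theorem sum_piFinset_eq_primeSum (H : ConvFun) (c₁ x : ℝ) (r : ℕ) (y : ℝ) :
    ∑ u ∈ Fintype.piFinset (fun _ : Fin r => primesIn 0 ⌊x ^ 2⌋₊),
        (if win c₁ x y (∏ i, ((u i : ℕ) : ℝ)) then ∏ i, wtH H x (u i) else 0) =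
      primeSum c₁ x H r y := by
  induction r generalizing y with
  | zero =>
    rw [piFinset_fin_zero, primeSum_zero]
    simp [win]
  | succ r ih =>
    rw [sum_piFinset_succ, primeSum_succ]
    refine Finset.sum_congr rfl fun p hp => ?_
    have hp0 : (0 : ℝ) < p := by exact_mod_cast (primesIn_prime hp).pos
    rw [← ih (y / p), Finset.mul_sum]
    refine Finset.sum_congr rfl fun u _ => ?_
    simp only [Fin.prod_univ_succ, Fin.cons_zero, Fin.cons_succ]
    have hwin : win c₁ x y ((p : ℝ) * ∏ i, ((u i : ℕ) : ℝ)) ↔ win c₁ x (y / p) (∏ i, ((u i : ℕ) : ℝ)) := by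
      simp only [win]
      rw [div_lt_iff₀ hp0, div_mul_eq_mul_div, le_div_iff₀ hp0]
      constructor <;> rintro ⟨h1, h2⟩ <;> constructor <;> linarith [h1, h2, mul_comm (p : ℝ) (∏ i, ((u i : ℕ) : ℝ))]
    by_cases h : win c₁ x (y / p) (∏ i, ((u i : ℕ) : ℝ))
    · rw [if_pos (hwin.mpr h), if_pos h, wtH]
    · rw [if_neg (fun h' => h (hwin.mp h')), if_neg h, mul_zero]

/-- The layer sum over `r`-subsets is `1/r!` times the sum over injective `r`-tuples. [folklore] -/
theorem layer_eq (H : ConvFun) (c₁ x : ℝ) (r : ℕ) (y : ℝ) :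
    ∑ s ∈ (primesIn 0 ⌊x ^ 2⌋₊).powersetCard r,
        (if win c₁ x y (∏ p ∈ s, ((p : ℕ) : ℝ)) then ∏ p ∈ s, wtH H x p else 0) =
      ((r.factorial : ℂ)⁻¹) *
        ∑ u ∈ (Fintype.piFinset (fun _ : Fin r => primesIn 0 ⌊x ^ 2⌋₊)).filter
            (fun u => Function.Injective u),
          (if win c₁ x y (∏ i, ((u i : ℕ) : ℝ)) then ∏ i, wtH H x (u i) else 0) := by
  classical
  have h := sum_filter_injective_eq (primesIn 0 ⌊x ^ 2⌋₊) r
    (fun s => (if win c₁ x y (∏ p ∈ s, ((p : ℕ) : ℝ)) then ∏ p ∈ s, wtH H x p else 0))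
  have hrew : ∑ u ∈ (Fintype.piFinset (fun _ : Fin r => primesIn 0 ⌊x ^ 2⌋₊)).filter
      (fun u => Function.Injective u),
      (if win c₁ x y (∏ i, ((u i : ℕ) : ℝ)) then ∏ i, wtH H x (u i) else 0) =
      ∑ u ∈ (Fintype.piFinset (fun _ : Fin r => primesIn 0 ⌊x ^ 2⌋₊)).filter
      (fun u => Function.Injective u),
      (if win c₁ x y (∏ p ∈ Finset.univ.image u, (p : ℝ)) then ∏ p ∈ Finset.univ.image u, wtH H x p else 0) := by
    refine Finset.sum_congr rfl fun u hu => ?_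
    have hinj : Function.Injective u := (Finset.mem_filter.mp hu).2
    rw [prod_image_univ_of_injective hinj, prod_image_univ_of_injective hinj]
  rw [hrew, h, nsmul_eq_mul, ← mul_assoc, inv_mul_cancel₀ (by exact_mod_cast r.factorial_ne_zero), one_mul]

/-- Terms with a non-injective tuple: bounded by `W₀^r` times the indicator of the "bad" tuples.
[folklore] -/
theorem norm_term_le_indicator {H : ConvFun} {ε W₀ c₁ x : ℝ} (hx : 1 < x) (hW : 1 ≤ W₀)
    (hHW : ∀ p, ‖wtH H x p‖ ≤ W₀) (hH : ∀ t, H t ≠ 0 → ε ≤ t) {r : ℕ} (y : ℝ) (u : Fin r → ℕ) :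
    ‖(if win c₁ x y (∏ i, ((u i : ℕ) : ℝ)) then ∏ i, wtH H x (u i) else 0)‖ ≤
      W₀ ^ r * (if (win c₁ x y (∏ i, ((u i : ℕ) : ℝ)) ∧ ∀ i, x ^ ε ≤ ((u i : ℕ) : ℝ)) then 1 else 0) := by
  have hW0 : 0 ≤ W₀ := by linarith
  by_cases hw : win c₁ x y (∏ i, ((u i : ℕ) : ℝ))
  · rw [if_pos hw]
    by_cases hall : ∀ i, x ^ ε ≤ ((u i : ℕ) : ℝ)
    · rw [if_pos ⟨hw, hall⟩, norm_prod, mul_one]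
      calc ∏ i, ‖wtH H x (u i)‖ ≤ ∏ _i : Fin r, W₀ :=
            Finset.prod_le_prod (fun i _ => norm_nonneg _) fun i _ => hHW _
        _ = W₀ ^ r := by rw [Finset.prod_const, Finset.card_univ, Fintype.card_fin]
    · rw [if_neg (fun h => hall h.2), mul_zero]
      push Not at hall
      obtain ⟨i, hi⟩ := hall
      rw [Finset.prod_eq_zero (Finset.mem_univ i) (wtH_eq_zero_of_lt hH hx hi), norm_zero]
  · rw [if_neg hw, norm_zero]
    positivity

/-- **Non-injective tuples contribute little**:
`‖∑_{u ∉ Inj} [∏u ∈ window] ∏ t H(t)‖ ≤ W₀^r r^r (2(yη + 1)/x^ε + √(y(1+η)) + 1)`. [folklore] -/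
theorem norm_sum_nonInj_le {H : ConvFun} {ε W₀ c₁ x : ℝ} (hx : 1 < x) (hε : 0 < ε) (hW : 1 ≤ W₀)
    (hHW : ∀ p, ‖wtH H x p‖ ≤ W₀) (hH : ∀ t, H t ≠ 0 → ε ≤ t) (r : ℕ) {y : ℝ}
    (hy : 0 ≤ y) :
    ‖∑ u ∈ (Fintype.piFinset (fun _ : Fin r => primesIn 0 ⌊x ^ 2⌋₊)).filter
          (fun u => ¬ Function.Injective u),
        (if win c₁ x y (∏ i, ((u i : ℕ) : ℝ)) then ∏ i, wtH H x (u i) else 0)‖ ≤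
      W₀ ^ r * ((r : ℝ) ^ r * ((y * eta c₁ x + 1) * (2 / x ^ ε) + (Real.sqrt (y * (1 + eta c₁ x)) + 1))) := by
  classical
  set P := primesIn 0 ⌊x ^ 2⌋₊ with hP
  have hη0 : 0 < eta c₁ x := eta_pos c₁ x
  have hyy : y ≤ y * (1 + eta c₁ x) := by nlinarith
  have hz : 1 ≤ x ^ ε := Real.one_le_rpow hx.le hε.le
  refine (norm_sum_le _ _).trans ?_
  refine (Finset.sum_le_sum fun u _ => norm_term_le_indicator hx hW hHW hH y u).trans ?_
  rw [← Finset.mul_sum, Finset.sum_boole, ← Finset.filter_filter]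
  refine mul_le_mul_of_nonneg_left ?_ (by positivity)
  have := card_nonInj_le P (fun p hp => primesIn_prime hp) r hy hyy hz
  refine le_trans (le_of_eq ?_) (this.trans (le_of_eq (by ring)))
  congr 2
  ext u
  simp only [Finset.mem_filter, win, and_assoc]

/-- Layers with more than `M` primes vanish: `M + 1` primes `≥ x^ε` do not fit below `4x`
(when `4x ≤ x^{(M+1)ε}`). [folklore] -/
theorem layer_eq_zero_of_lt {H : ConvFun} {ε c₁ x : ℝ} (hx : 1 < x) (hε : 0 < ε)
    (hH : ∀ t, H t ≠ 0 → ε ≤ t) (hc₁ : 0 ≤ c₁) {M : ℕ}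
    (hxbig : 4 * x < x ^ ((M + 1 : ℝ) * ε)) {r : ℕ} (hr : M < r) {y : ℝ}
    (hy : y ≤ 2 * x) (s : Finset ℕ) (hs : s ∈ (primesIn 0 ⌊x ^ 2⌋₊).powersetCard r) :
    (if win c₁ x y (∏ p ∈ s, ((p : ℕ) : ℝ)) then ∏ p ∈ s, wtH H x p else 0) = 0 := by
  classical
  have hx0 : 0 < x := by linarith
  rw [Finset.mem_powersetCard] at hs
  split_ifs with hw
  · by_cases hall : ∀ p ∈ s, x ^ ε ≤ (p : ℝ)
    · exfalso
      have hprod : x ^ ((M + 1 : ℝ) * ε) ≤ ∏ p ∈ s, ((p : ℕ) : ℝ) := by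
        have h1 : ∏ _p ∈ s, (x ^ ε) ≤ ∏ p ∈ s, ((p : ℕ) : ℝ) :=
          Finset.prod_le_prod (fun p _ => by positivity) fun p hp => hall p hp
        rw [Finset.prod_const, hs.2] at h1
        refine le_trans ?_ h1
        rw [← Real.rpow_natCast, ← Real.rpow_mul hx0.le]
        refine Real.rpow_le_rpow_of_exponent_le hx.le ?_
        rw [mul_comm]
        have : (M + 1 : ℝ) ≤ (r : ℝ) := by exact_mod_cast hr
        exact mul_le_mul_of_nonneg_left this hε.le
      obtain ⟨_, h2⟩ := hw
      have hη1 : eta c₁ x ≤ 1 := eta_le_one hc₁ x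
      have h3 : y * (1 + eta c₁ x) ≤ 2 * x * 2 :=
        mul_le_mul hy (by linarith) (by linarith [eta_pos c₁ x]) (by linarith)
      linarith
    · push Not at hall
      obtain ⟨p, hp, hpx⟩ := hall
      exact Finset.prod_eq_zero hp (wtH_eq_zero_of_lt hH hx hpx)
  · rfl

/-- `S_H(y)` is the sum of its layers `r = 0, …, M`. [folklore] -/
theorem SsumH_eq_sum_layers {H : ConvFun} {ε c₁ x : ℝ} (hx : 1 < x) (hε : 0 < ε)
    (hH : ∀ t, H t ≠ 0 → ε ≤ t) (hc₁ : 0 ≤ c₁) {M : ℕ}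
    (hxbig : 4 * x < x ^ ((M + 1 : ℝ) * ε)) {y : ℝ} (hy : y ≤ 2 * x) :
    SsumH H c₁ x y = ∑ r ∈ Finset.range (M + 1), ∑ s ∈ (primesIn 0 ⌊x ^ 2⌋₊).powersetCard r,
      (if win c₁ x y (∏ p ∈ s, ((p : ℕ) : ℝ)) then ∏ p ∈ s, wtH H x p else 0) := by
  rw [SsumH, Finset.sum_powerset]
  set N := (primesIn 0 ⌊x ^ 2⌋₊).card
  have hvan : ∀ r, M < r → ∑ s ∈ (primesIn 0 ⌊x ^ 2⌋₊).powersetCard r,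
      (if win c₁ x y (∏ p ∈ s, ((p : ℕ) : ℝ)) then ∏ p ∈ s, wtH H x p else 0) = 0 := fun r hr =>
    Finset.sum_eq_zero fun s hs => layer_eq_zero_of_lt hx hε hH hc₁ hxbig hr hy s hs
  have hempty : ∀ r, N < r → ∑ s ∈ (primesIn 0 ⌊x ^ 2⌋₊).powersetCard r,
      (if win c₁ x y (∏ p ∈ s, ((p : ℕ) : ℝ)) then ∏ p ∈ s, wtH H x p else 0) = 0 := fun r hr => by
    rw [Finset.powersetCard_eq_empty.mpr hr, Finset.sum_empty]
  rcases le_or_gt N M with hle | hlt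
  · rw [← Finset.sum_range_add_sum_Ico _ (show N + 1 ≤ M + 1 by omega)]
    rw [Finset.sum_eq_zero (s := Finset.Ico (N + 1) (M + 1)) fun r hr => hempty r (by
      have := (Finset.mem_Ico.mp hr).1; omega), add_zero]
  · rw [← Finset.sum_range_add_sum_Ico _ (show M + 1 ≤ N + 1 by omega)]
    rw [Finset.sum_eq_zero (s := Finset.Ico (M + 1) (N + 1)) fun r hr => hvan r (by
      have := (Finset.mem_Ico.mp hr).1; omega), add_zero]

/-- **`S_H(y)` through ordered tuples**: for `1 ≤ y ≤ 2x` (and `x` large),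
`S_H(y) = ∑_{r=1}^{M} (1/r!) (Σ_r(y) − N_r(y))`, where `Σ_r = primeSum` is the sum over all
ordered `r`-tuples and `N_r` the part over the non-injective ones. [folklore] -/
theorem SsumH_eq_sum_primeSum_sub {H : ConvFun} {ε c₁ x : ℝ} (hx : 1 < x) (hε : 0 < ε)
    (hH : ∀ t, H t ≠ 0 → ε ≤ t) (hc₁ : 0 ≤ c₁) {M : ℕ}
    (hxbig : 4 * x < x ^ ((M + 1 : ℝ) * ε)) {y : ℝ} (hy1 : 1 ≤ y) (hy : y ≤ 2 * x) :
    SsumH H c₁ x y = ∑ r ∈ Icc 1 M, ((r.factorial : ℂ)⁻¹) * (primeSum c₁ x H r y -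
      ∑ u ∈ (Fintype.piFinset (fun _ : Fin r => primesIn 0 ⌊x ^ 2⌋₊)).filter
          (fun u => ¬ Function.Injective u),
        (if win c₁ x y (∏ i, ((u i : ℕ) : ℝ)) then ∏ i, wtH H x (u i) else 0)) := by
  classical
  rw [SsumH_eq_sum_layers hx hε hH hc₁ hxbig hy, Finset.range_eq_Ico,
    Finset.sum_eq_sum_Ico_succ_bot (by omega : 0 < M + 1), Finset.Ico_add_one_right_eq_Icc]
  have h0 : ∑ s ∈ (primesIn 0 ⌊x ^ 2⌋₊).powersetCard 0,
      (if win c₁ x y (∏ p ∈ s, ((p : ℕ) : ℝ)) then ∏ p ∈ s, wtH H x p else 0) = 0 := by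
    rw [Finset.powersetCard_zero, Finset.sum_singleton, Finset.prod_empty, if_neg]
    rintro ⟨h1, _⟩
    linarith
  rw [h0, zero_add]
  refine Finset.sum_congr rfl fun r _ => ?_
  rw [layer_eq]
  congr 1
  have hsplit := Finset.sum_filter_add_sum_filter_not (Fintype.piFinset (fun _ : Fin r => primesIn 0 ⌊x ^ 2⌋₊))
    (fun u => Function.Injective u)
    (fun u => (if win c₁ x y (∏ i, ((u i : ℕ) : ℝ)) then ∏ i, wtH H x (u i) else 0))
  rw [sum_piFinset_eq_primeSum] at hsplit
  linear_combination hsplit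

/-! ### The data of the construction -/

/-- The data of Ford's construction in product form: the number of blocks `M ≥ 2`, a half-width
`w ≤ 1/(4M²)` and a real non-negative Lipschitz bump `Φ ∈ C_c(ℝ)` living on `[1/M − w, 1/M + w]`
with `Φ(1/M) > 0` and `sup |Φ| ≤ 1/(4M)` (so that the weights stay in `[−1, 1]`). Ford's
`f_{1_M}` is then `∏_i u_i Φ(u_i)` ((3.5) becomes a product of one-variable convolution powers).
[cite: Ford2004, §3 (3.5) and Theorem 3] -/
structure Bump where
  /-- number of blocks `M` -/
  M : ℕ
  /-- half-width of the bump -/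
  w : ℝ
  /-- the bump -/
  Φ : ConvFun
  /-- a Lipschitz constant of the bump -/
  K : ℝ
  two_le : 2 ≤ M
  w_pos : 0 < w
  w_le : w ≤ 1 / (4 * (M : ℝ) ^ 2)
  supp : Φ.SuppIn (1 / M - w) (1 / M + w)
  isReal : Φ.IsReal
  nonneg : ∀ t, 0 ≤ (Φ t).re
  pos : 0 < (Φ (1 / M)).re
  norm_le : ∀ t, ‖Φ t‖ ≤ 1 / (4 * M)
  lip : ∀ t t', ‖Φ t - Φ t'‖ ≤ K * |t - t'|

namespace Bump

variable (B : Bump)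

/-- The lower end `ε = 1/M − w` of the support of `Φ`. [folklore] -/
def ε : ℝ := 1 / B.M - B.w

/-- `0 < M`. [folklore] -/
theorem M_pos : (0 : ℝ) < B.M := by have := B.two_le; positivity

/-- `1 ≤ M`. [folklore] -/
theorem one_le_M : (1 : ℝ) ≤ B.M := by exact_mod_cast le_trans (by norm_num) B.two_le

/-- `w ≤ 1/(4M²)`. [folklore] -/
theorem w_le_inv_sq : B.w ≤ 1 / (4 * (B.M : ℝ) ^ 2) := B.w_le

/-- `2 ≤ M` (as reals). [folklore] -/
theorem two_le_M : (2 : ℝ) ≤ B.M := by exact_mod_cast B.two_le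

/-- `w < 1/(2M(M+1))`. [folklore] -/
theorem w_lt : B.w < 1 / (2 * (B.M : ℝ) * (B.M + 1)) := by
  have hM := B.two_le_M
  refine lt_of_le_of_lt B.w_le ?_
  rw [div_lt_div_iff₀ (by positivity) (by positivity), one_mul, one_mul]
  nlinarith

/-- `0 < ε`. [folklore] -/
theorem ε_pos : 0 < B.ε := by
  have hM := B.one_le_M
  have h1 : B.w < 1 / (2 * (B.M : ℝ) * (B.M + 1)) := B.w_lt
  have h2 : 1 / (2 * (B.M : ℝ) * (B.M + 1)) ≤ 1 / B.M :=
    div_le_div_of_nonneg_left (by norm_num) (by positivity) (by nlinarith)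
  rw [ε]; linarith

/-- `ε ≤ 1`. [folklore] -/
theorem ε_le_one : B.ε ≤ 1 := by
  have hM := B.one_le_M
  have h1 : 1 / (B.M : ℝ) ≤ 1 := by rw [div_le_one (by positivity)]; exact hM
  have := B.w_pos
  rw [ε]; linarith

/-- `ε < 1/M`. [folklore] -/
theorem ε_lt_inv : B.ε < 1 / B.M := by have := B.w_pos; rw [ε]; linarith

/-- `(M+1) ε > 1`: `M + 1` factors of size `≥ x^ε` do not fit below `x` (indeed `≥ x · x^{1/(2M)}`).
[folklore] -/
theorem one_add_lt_succ_mul_ε : 1 + 1 / (2 * (B.M : ℝ)) < (B.M + 1) * B.ε := by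
  have hM := B.one_le_M
  have h1 := B.w_lt
  rw [ε]
  have hM0 : (0 : ℝ) < B.M := B.M_pos
  have : (B.M + 1 : ℝ) * (1 / B.M - B.w) = 1 + 1 / B.M - (B.M + 1) * B.w := by
    rw [mul_sub, mul_one_div, add_div, div_self hM0.ne']
  rw [this]
  have h2 : (B.M + 1 : ℝ) * B.w < 1 / (2 * B.M) := by
    have := mul_lt_mul_of_pos_left h1 (show (0 : ℝ) < B.M + 1 by positivity)
    rw [show (B.M + 1 : ℝ) * (1 / (2 * B.M * (B.M + 1))) = 1 / (2 * B.M) by field_simp] at this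
    exact this
  have h3 : 1 / (2 * (B.M : ℝ)) + 1 / (2 * B.M) = 1 / B.M := by field_simp; ring
  linarith

/-- The upper end of the support of the `M`-fold powers stays below `2`: `M (1/M + w) ≤ 2`, and
indeed `a (1/M + w) ≤ 2` for all `a ≤ M`. [folklore] -/
theorem mul_upper_le_two {a : ℕ} (ha : a ≤ B.M) : (a : ℝ) * (1 / B.M + B.w) ≤ 2 := by
  have hM := B.one_le_M
  have hM0 := B.M_pos
  have ha' : (a : ℝ) ≤ B.M := by exact_mod_cast ha
  have hw : B.w ≤ 1 / B.M := by
    refine B.w_le.trans (div_le_div_of_nonneg_left (by norm_num) hM0 (by nlinarith))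
  have hpos : 0 ≤ 1 / (B.M : ℝ) + B.w := by have := B.w_pos; positivity
  calc (a : ℝ) * (1 / B.M + B.w) ≤ B.M * (1 / B.M + 1 / B.M) :=
        mul_le_mul ha' (by linarith) hpos hM0.le
      _ = 2 := by field_simp; ring

/-! ### The function `G = ∑ c_a Φ^{*a}` and the prime weights -/

/-- `G = ∑_{a=1}^{M} c_a Φ^{*a}`, `c_a = (−1)^{a+1}/a` ("`log(1 + Φ)`" in the convolution algebra):
the one-variable function with `G(t)/1 = ` the fibre integrals of all the `f_α/u` of [Ford2004]
(3.5) at once. [cite: Ford2004, §3 (3.5), (3.8)] -/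
def G : ConvFun := ∑ a ∈ Icc 1 B.M, (logCoeff ℂ a) • B.Φ.cpow a

/-- `G` in the unitised algebra: `(G : U) = ∑ c_a (Φ : U)^a`. [folklore] -/
theorem inr_G : (B.G : ConvFun.U) = ∑ a ∈ Icc 1 B.M, logCoeff ℂ a • (B.Φ : ConvFun.U) ^ a := by
  rw [G]
  have : ((∑ a ∈ Icc 1 B.M, logCoeff ℂ a • B.Φ.cpow a : ConvFun) : ConvFun.U) =
      ∑ a ∈ Icc 1 B.M, ((logCoeff ℂ a • B.Φ.cpow a : ConvFun) : ConvFun.U) :=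
    map_sum (Unitization.inrNonUnitalAlgHom ℂ ConvFun) _ _
  rw [this]
  refine Finset.sum_congr rfl fun a ha => ?_
  rw [Unitization.inr_smul, ConvFun.inr_cpow _ (by have := (Finset.mem_Icc.mp ha).1; omega)]

/-- Pointwise: `G(t) = ∑ c_a Φ^{*a}(t)`. [folklore] -/
theorem G_apply (t : ℝ) : B.G t = ∑ a ∈ Icc 1 B.M, logCoeff ℂ a * B.Φ.cpow a t := by
  rw [G, ConvFun.sum_apply]
  rfl

/-- `|c_a| ≤ 1`. [folklore] -/
theorem norm_logCoeff_le (a : ℕ) : ‖(logCoeff ℂ a)‖ ≤ 1 := by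
  rw [logCoeff, norm_div, norm_pow, norm_neg, norm_one, one_pow]
  rcases Nat.eq_zero_or_pos a with rfl | ha
  · simp
  · rw [Complex.norm_natCast, div_le_one (by exact_mod_cast ha)]
    exact_mod_cast ha

/-- `∫ ‖Φ‖ ≤ 1` (indeed `≤ 2w/(4M)`). [folklore] -/
theorem integral_norm_Φ_le_one : ∫ t, ‖B.Φ t‖ ≤ 1 := by
  have hM0 := B.M_pos
  have h := B.Φ.integral_norm_le B.norm_le B.supp (by linarith [B.w_pos])
  have hw : B.w ≤ 1 := by
    refine B.w_le.trans ?_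
    rw [div_le_one (by positivity)]; nlinarith [B.one_le_M]
  calc ∫ t, ‖B.Φ t‖ ≤ 1 / (4 * B.M) * (1 / B.M + B.w - (1 / B.M - B.w)) := h
    _ = B.w / (2 * B.M) := by field_simp; ring
    _ ≤ 1 := by
        rw [div_le_one (by positivity)]; nlinarith [B.one_le_M]

/-- Sup bound for the powers: `‖Φ^{*a}(t)‖ ≤ 1/(4M)`. [folklore] -/
theorem norm_cpow_Φ_le {a : ℕ} (ha : a ≠ 0) (t : ℝ) : ‖B.Φ.cpow a t‖ ≤ 1 / (4 * B.M) := by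
  have h := B.Φ.norm_cpow_le B.norm_le ha t
  have hI := B.integral_norm_Φ_le_one
  have hI0 := B.Φ.integral_norm_nonneg
  have hM0 := B.M_pos
  calc ‖B.Φ.cpow a t‖ ≤ (∫ t, ‖B.Φ t‖) ^ (a - 1) * (1 / (4 * B.M)) := h
    _ ≤ 1 ^ (a - 1) * (1 / (4 * B.M)) := by gcongr
    _ = 1 / (4 * B.M) := by rw [one_pow, one_mul]

/-- Lipschitz bound for the powers: `Φ^{*a}` is `K`-Lipschitz. [folklore] -/
theorem norm_cpow_Φ_sub_le {a : ℕ} (ha : a ≠ 0) (t t' : ℝ) :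
    ‖B.Φ.cpow a t - B.Φ.cpow a t'‖ ≤ B.K * |t - t'| := by
  have hK0 : 0 ≤ B.K := nonneg_of_lip B.lip
  have h := B.Φ.norm_cpow_sub_le B.lip ha t t'
  have hI := B.integral_norm_Φ_le_one
  have hI0 := B.Φ.integral_norm_nonneg
  calc ‖B.Φ.cpow a t - B.Φ.cpow a t'‖ ≤ (∫ t, ‖B.Φ t‖) ^ (a - 1) * B.K * |t - t'| := h
    _ ≤ 1 ^ (a - 1) * B.K * |t - t'| := by gcongr
    _ = B.K * |t - t'| := by rw [one_pow, one_mul]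

/-- `‖G(t)‖ ≤ 1/4`. [folklore] -/
theorem norm_G_le (t : ℝ) : ‖B.G t‖ ≤ 1 / 4 := by
  have hM0 := B.M_pos
  rw [G_apply]
  calc ‖∑ a ∈ Icc 1 B.M, logCoeff ℂ a * B.Φ.cpow a t‖
      ≤ ∑ a ∈ Icc 1 B.M, ‖logCoeff ℂ a * B.Φ.cpow a t‖ := norm_sum_le _ _
    _ ≤ ∑ a ∈ Icc 1 B.M, 1 * (1 / (4 * (B.M : ℝ))) := by
        refine Finset.sum_le_sum fun a ha => ?_
        rw [norm_mul]
        exact mul_le_mul (norm_logCoeff_le a) (B.norm_cpow_Φ_le (by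
          have := (Finset.mem_Icc.mp ha).1; omega) t) (norm_nonneg _) zero_le_one
    _ = B.M * (1 / (4 * B.M)) := by
        rw [Finset.sum_const, Nat.card_Icc, Nat.add_sub_cancel, nsmul_eq_mul, one_mul]
    _ = 1 / 4 := by field_simp

/-- `G` is `M K`-Lipschitz. [folklore] -/
theorem norm_G_sub_le (t t' : ℝ) : ‖B.G t - B.G t'‖ ≤ B.M * B.K * |t - t'| := by
  rw [G_apply, G_apply, ← Finset.sum_sub_distrib]
  calc ‖∑ a ∈ Icc 1 B.M, (logCoeff ℂ a * B.Φ.cpow a t - logCoeff ℂ a * B.Φ.cpow a t')‖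
      ≤ ∑ a ∈ Icc 1 B.M, ‖logCoeff ℂ a * B.Φ.cpow a t - logCoeff ℂ a * B.Φ.cpow a t'‖ :=
        norm_sum_le _ _
    _ ≤ ∑ a ∈ Icc 1 B.M, 1 * (B.K * |t - t'|) := by
        refine Finset.sum_le_sum fun a ha => ?_
        rw [← mul_sub, norm_mul]
        exact mul_le_mul (norm_logCoeff_le a) (B.norm_cpow_Φ_sub_le (by
          have := (Finset.mem_Icc.mp ha).1; omega) t t') (norm_nonneg _) zero_le_one
    _ = B.M * B.K * |t - t'| := by
        rw [Finset.sum_const, Nat.card_Icc, Nat.add_sub_cancel, nsmul_eq_mul]; ring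

/-- `G` lives on `[ε, 2]`. [folklore] -/
theorem suppIn_G : B.G.SuppIn B.ε 2 := by
  rw [G]
  refine ConvFun.SuppIn.sum _ fun a ha => ConvFun.SuppIn.smul ?_ _
  have ha1 : 1 ≤ a := (Finset.mem_Icc.mp ha).1
  have haM : a ≤ B.M := (Finset.mem_Icc.mp ha).2
  have hlo : B.ε ≤ a * (1 / B.M - B.w) := by
    rw [ε]
    have : (1 : ℝ) ≤ a := by exact_mod_cast ha1
    have hε := B.ε_pos
    rw [ε] at hε
    nlinarith
  exact (B.supp.cpow (by linarith [B.w_pos]) (by omega)).mono hlo (B.mul_upper_le_two haM)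

/-- `G` is real-valued. [folklore] -/
theorem isReal_G : B.G.IsReal := by
  rw [G]
  refine ConvFun.IsReal.sum _ fun a ha => ?_
  have : (logCoeff ℂ a) = ((logCoeff ℝ a : ℝ) : ℂ) := by
    simp [logCoeff]
  rw [this]
  exact (B.isReal.cpow (by have := (Finset.mem_Icc.mp ha).1; omega)).smul _

/-- The weight of a prime: `g(p) = t_p G(t_p)`, `t_p = log p/log x`. [cite: Ford2004, §3 (3.5)] -/
abbrev wt (x : ℝ) (p : ℕ) : ℂ := wtH B.G x p

/-- `‖g(p)‖ ≤ 1/2`. [folklore] -/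
theorem norm_wt_le (x : ℝ) (p : ℕ) : ‖B.wt x p‖ ≤ 1 / 2 := by
  rw [wt, wtH, norm_mul, Complex.norm_real, Real.norm_eq_abs]
  by_cases hG : B.G (tOf x p) = 0
  · rw [hG, norm_zero, mul_zero]; norm_num
  · obtain ⟨h1, h2⟩ := B.suppIn_G _ hG
    have h0 : 0 ≤ tOf x p := le_trans B.ε_pos.le h1
    rw [abs_of_nonneg h0]
    calc tOf x p * ‖B.G (tOf x p)‖ ≤ 2 * (1 / 4) :=
          mul_le_mul h2 (B.norm_G_le _) (norm_nonneg _) (by norm_num)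
      _ = 1 / 2 := by norm_num

/-- The weights are real. [folklore] -/
theorem wt_im (x : ℝ) (p : ℕ) : (B.wt x p).im = 0 := by
  rw [wt, wtH, Complex.mul_im, Complex.ofReal_im, Complex.ofReal_re, B.isReal_G, mul_zero, zero_mul,
    add_zero]

/-- `G` vanishes below `ε`. [folklore] -/
theorem G_vanish : ∀ t, B.G t ≠ 0 → B.ε ≤ t := fun t ht => (B.suppIn_G t ht).1

/-- The weight vanishes unless `x^ε ≤ p`. [folklore] -/
theorem wt_eq_zero_of_lt {x : ℝ} (hx : 1 < x) {p : ℕ} (hp : (p : ℝ) < x ^ B.ε) : B.wt x p = 0 :=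
  wtH_eq_zero_of_lt B.G_vanish hx hp

/-! ### The numbers `B(n)` and the perturbation `b_n` -/

/-- `B(n) = ∑_{s ⊆ {p ≤ x²}, ∏ s = n} ∏_{p ∈ s} g(p)` (`= μ²(n) ∏_{p ∣ n} g(p)`): the sum over
SETS of primes of the product weights — Ford's `b_n = f_α(log p_1/log n, …)` summed over all
`α ∈ P(M)` at once, for the product-form `f_{1_M}`. [cite: Ford2004, §3 (3.5), Theorem 3] -/
def Bfun (x : ℝ) (n : ℕ) : ℂ :=
  ∑ s ∈ (primesIn 0 ⌊x ^ 2⌋₊).powerset with (∏ p ∈ s, p) = n, ∏ p ∈ s, B.wt x p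

/-- At most one set of primes has a given product, so `‖B(n)‖ ≤ 1`. [folklore] -/
theorem norm_Bfun_le (x : ℝ) (n : ℕ) : ‖B.Bfun x n‖ ≤ 1 := by
  classical
  rw [Bfun]
  set T := ((primesIn 0 ⌊x ^ 2⌋₊).powerset).filter (fun s => ∏ p ∈ s, p = n) with hT
  have hcard : T.card ≤ 1 := by
    rw [Finset.card_le_one]
    intro s hs t ht
    rw [hT, Finset.mem_filter, Finset.mem_powerset] at hs ht
    exact prod_primes_injective (fun p hp => primesIn_prime (hs.1 hp))
      (fun p hp => primesIn_prime (ht.1 hp)) (hs.2.trans ht.2.symm)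
  have hterm : ∀ s ∈ T, ‖∏ p ∈ s, B.wt x p‖ ≤ 1 := by
    intro s _
    rw [norm_prod]
    exact Finset.prod_le_one (fun p _ => norm_nonneg _) fun p _ => (B.norm_wt_le x p).trans (by norm_num)
  calc ‖∑ s ∈ T, ∏ p ∈ s, B.wt x p‖ ≤ ∑ s ∈ T, ‖∏ p ∈ s, B.wt x p‖ := norm_sum_le _ _
    _ ≤ ∑ s ∈ T, (1 : ℝ) := Finset.sum_le_sum hterm
    _ = T.card := by rw [Finset.sum_const, nsmul_eq_mul, mul_one]
    _ ≤ 1 := by exact_mod_cast hcard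

/-- `B(n)` is real. [folklore] -/
theorem Bfun_im (x : ℝ) (n : ℕ) : (B.Bfun x n).im = 0 := by
  rw [Bfun, Complex.im_sum]
  refine Finset.sum_eq_zero fun s _ => ?_
  have : ∏ p ∈ s, B.wt x p = ((∏ p ∈ s, (B.wt x p).re : ℝ) : ℂ) := by
    rw [Complex.ofReal_prod]
    refine Finset.prod_congr rfl fun p _ => ?_
    apply Complex.ext <;> simp [B.wt_im]
  rw [this, Complex.ofReal_im]

/-! ### From integers to sets of primes -/

/-- `∑_{n ∈ J} F(n) B(n) = ∑_{s ⊆ {p ≤ x²}, ∏ s ∈ J} F(∏ s) ∏_{p ∈ s} g(p)`. [folklore] -/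
theorem sum_mul_Bfun_eq (x : ℝ) (J : Finset ℕ) (F : ℕ → ℂ) :
    ∑ n ∈ J, F n * B.Bfun x n =
      ∑ s ∈ (primesIn 0 ⌊x ^ 2⌋₊).powerset with (∏ p ∈ s, p) ∈ J,
        F (∏ p ∈ s, p) * ∏ p ∈ s, B.wt x p := by
  classical
  simp only [Bfun, Finset.mul_sum, Finset.sum_filter]
  rw [Finset.sum_comm]
  refine Finset.sum_congr rfl fun s _ => ?_
  simp_rw [mul_ite, mul_zero]
  rw [Finset.sum_ite_eq]

/-! ### The main term vanishes: `exp(log(1 + Φ)) = 1 + Φ` in the convolution algebra -/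

/-- **The main terms cancel** ([Ford2004] (3.4) ⟸ (3.8) ⟸ (3.9)–(3.10)): for
`1/M + w < Y ≤ 1`, `∑_{r=1}^{M} (1/r!) G^{*r}(Y) = 0`. Indeed in the unitised convolution algebra
`∑_r (1/r!) G^r = exp(log(1+Φ)) − 1 + (degree > M) = Φ + junk`, and `Φ(Y) = 0`, while the junk
vanishes at `Y ≤ 1 < (M+1)ε` by the support band of `Φ^{*i}`, `i > M`.
[cite: Ford2004, §3 (3.8)–(3.10)] -/
theorem mainTerm_eq_zero {Y : ℝ} (hY1 : Y ≤ 1) (hY2 : 1 / B.M + B.w < Y) :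
    ∑ r ∈ Icc 1 B.M, ((r.factorial : ℂ)⁻¹) * B.G.cpow r Y = 0 := by
  -- move to `U`
  have h1 : ∑ r ∈ Icc 1 B.M, ((r.factorial : ℂ)⁻¹) * B.G.cpow r Y =
      ConvFun.ev Y (∑ r ∈ Icc 1 B.M, algebraMap ℂ ConvFun.U ((r.factorial : ℂ)⁻¹) *
        (∑ a ∈ Icc 1 B.M, logCoeff ℂ a • ((B.Φ : ConvFun.U) ^ a - (0 : ConvFun.U) ^ a)) ^ r) := by
    rw [map_sum]
    refine Finset.sum_congr rfl fun r hr => ?_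
    have hr0 : r ≠ 0 := by have := (Finset.mem_Icc.mp hr).1; omega
    have hG : ∑ a ∈ Icc 1 B.M, logCoeff ℂ a • ((B.Φ : ConvFun.U) ^ a - (0 : ConvFun.U) ^ a) =
        (B.G : ConvFun.U) := by
      rw [B.inr_G]
      refine Finset.sum_congr rfl fun a ha => ?_
      rw [zero_pow (by have := (Finset.mem_Icc.mp ha).1; omega), sub_zero]
    rw [hG, Algebra.algebraMap_eq_smul_one, smul_mul_assoc, one_mul, LinearMap.map_smul,
      ← ConvFun.inr_cpow _ hr0, ConvFun.ev_inr, smul_eq_mul]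
  rw [h1, apply_sum_pow_logCoeff_eq (𝕜 := ℂ) B.M (B.Φ : ConvFun.U) 0 (ConvFun.ev Y)]
  · -- the surviving terms: `m = 1` gives `Φ(Y) = 0`, `m ≥ 2` carry `0^{m-1} = 0`
    refine Finset.sum_eq_zero fun m hm => ?_
    rcases eq_or_ne m 1 with rfl | hm1
    · simp only [Nat.sub_self, pow_zero, one_mul, mul_one, sub_zero, ConvFun.ev_inr]
      exact B.supp.eq_zero (Or.inr hY2)
    · have : m - 1 ≠ 0 := by have := (Finset.mem_Icc.mp hm).1; omega
      rw [zero_pow this, mul_zero, mul_zero, map_zero]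
  · -- junk of degree `> M` vanishes at `Y ≤ 1`
    intro i j hij
    rcases eq_or_ne j 0 with rfl | hj
    · rw [pow_zero, mul_one]
      rw [add_zero] at hij
      refine ConvFun.ev_pow_eq_zero B.supp (by linarith [B.w_pos]) (by omega) (Or.inl ?_)
      have h2 := B.one_add_lt_succ_mul_ε
      have h3 : (B.M + 1 : ℝ) * B.ε ≤ i * (1 / B.M - B.w) := by
        rw [Bump.ε]
        have : (B.M + 1 : ℝ) ≤ i := by exact_mod_cast hij
        exact mul_le_mul_of_nonneg_right this B.ε_pos.le
      have hM0 := B.M_pos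
      have : (0 : ℝ) < 1 / (2 * B.M) := by positivity
      linarith
    · rw [zero_pow hj, mul_zero, map_zero]

/-! ### The divisor sums `T(d) = ∑_{n ∈ I, d ∣ n} B(n)` -/

/-- `T(d) = ∑_{x < n ≤ x + xη, d ∣ n} B(n)`. [cite: Ford2004, §3 (3.2)–(3.3)] -/
def Tsum (c₁ x : ℝ) (d : ℕ) : ℂ :=
  ∑ n ∈ (Finset.Ioc ⌊x⌋₊ ⌊x + x * eta c₁ x⌋₊).filter (fun n => d ∣ n), B.Bfun x n

/-- The inner sum after splitting off the primes of `d`. [folklore] -/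
def innerSum (c₁ x : ℝ) (d : ℕ) : ℂ :=
  ∑ t ∈ ((primesIn 0 ⌊x ^ 2⌋₊) \ d.primeFactors).powerset with
      win c₁ x (x / d) (∏ p ∈ t, ((p : ℕ) : ℝ)), ∏ p ∈ t, B.wt x p

/-- The window condition for `d ∏ t` versus the scaled window for `∏ t`. [folklore] -/
theorem mem_Ioc_iff_win {c₁ x : ℝ} (hx : 0 ≤ x) {d : ℕ} (hd : 0 < d) (m : ℕ) :
    d * m ∈ Finset.Ioc ⌊x⌋₊ ⌊x + x * eta c₁ x⌋₊ ↔ win c₁ x (x / d) (m : ℝ) := by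
  have hd' : (0 : ℝ) < d := by exact_mod_cast hd
  have hη := (eta_pos c₁ x).le
  rw [Finset.mem_Ioc, win, Nat.floor_lt hx, Nat.le_floor_iff (by positivity)]
  push_cast
  rw [div_lt_iff₀ hd', show x / d * (1 + eta c₁ x) = (x + x * eta c₁ x) / d by ring,
    le_div_iff₀ hd']
  constructor <;> rintro ⟨h1, h2⟩ <;> constructor <;> linarith

/-- **Splitting off the primes of `d`**: `T(d) = g(t₀) · innerSum` if `d` is squarefree with
prime factors `t₀ ⊆ {p ≤ x²}`, and `T(d) = 0` otherwise. [cite: Ford2004, §3 (3.3)] -/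
theorem Tsum_eq {c₁ x : ℝ} (hx : 0 ≤ x) {d : ℕ} (hd : 0 < d) :
    B.Tsum c₁ x d =
      if Squarefree d ∧ d.primeFactors ⊆ primesIn 0 ⌊x ^ 2⌋₊ then
        (∏ p ∈ d.primeFactors, B.wt x p) * B.innerSum c₁ x d
      else 0 := by
  classical
  have h1 : B.Tsum c₁ x d = ∑ n ∈ (Finset.Ioc ⌊x⌋₊ ⌊x + x * eta c₁ x⌋₊).filter (fun n => d ∣ n),
      1 * B.Bfun x n := by simp [Tsum]
  rw [h1, B.sum_mul_Bfun_eq]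
  simp only [one_mul]
  have h2 : ∑ s ∈ (primesIn 0 ⌊x ^ 2⌋₊).powerset with
        (∏ p ∈ s, p) ∈ (Finset.Ioc ⌊x⌋₊ ⌊x + x * eta c₁ x⌋₊).filter (fun n => d ∣ n), ∏ p ∈ s, B.wt x p =
      ∑ s ∈ (primesIn 0 ⌊x ^ 2⌋₊).powerset with
        (d ∣ ∏ p ∈ s, p ∧ (∏ p ∈ s, p) ∈ Finset.Ioc ⌊x⌋₊ ⌊x + x * eta c₁ x⌋₊), ∏ p ∈ s, B.wt x p := by
    refine Finset.sum_congr ?_ fun s _ => rfl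
    ext s
    simp only [Finset.mem_filter, and_comm]
  rw [h2, sum_powerset_filter_dvd _ (fun p hp => primesIn_prime hp)]
  split_ifs with h
  · congr 1
    rw [innerSum]
    refine Finset.sum_congr ?_ fun t _ => rfl
    ext t
    simp only [Finset.mem_filter]
    rw [mem_Ioc_iff_win hx hd]
    push_cast
    rfl
  · rfl

/-- **Removing the coprimality constraint**: if every prime of `d` is `≥ x^ε`,
`‖innerSum − S(x/d)‖ ≤ |t₀| ((yη + 1)/x^ε + 1)`, `y = x/d`. [folklore] -/
theorem norm_innerSum_sub_Ssum_le {c₁ x : ℝ} (hx : 1 < x) {d : ℕ} (hd : 0 < d)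
    (hbig : ∀ q ∈ d.primeFactors, x ^ B.ε ≤ (q : ℝ)) :
    ‖B.innerSum c₁ x d - SsumH B.G c₁ x (x / d)‖ ≤
      (d.primeFactors.card : ℝ) * ((x / d * eta c₁ x + 1) / x ^ B.ε + 1) := by
  classical
  set P := primesIn 0 ⌊x ^ 2⌋₊ with hP
  set t₀ := d.primeFactors with ht₀
  set y := x / d with hy
  have hy0 : 0 ≤ y := by positivity
  have hη := eta_pos c₁ x
  have hyy : y ≤ y * (1 + eta c₁ x) := by nlinarith
  have hz : 0 < x ^ B.ε := Real.rpow_pos_of_pos (by linarith) _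
  set f : Finset ℕ → ℂ := fun t => if win c₁ x y (∏ p ∈ t, ((p : ℕ) : ℝ)) then ∏ p ∈ t, B.wt x p else 0
    with hf
  -- `S − inner` is the sum over the sets meeting `t₀`
  have hsub : (P \ t₀).powerset ⊆ P.powerset := Finset.powerset_mono.mpr Finset.sdiff_subset
  have hdiff : SsumH B.G c₁ x y - B.innerSum c₁ x d = ∑ t ∈ P.powerset \ (P \ t₀).powerset, f t := by
    rw [SsumH, innerSum, Finset.sum_filter, ← Finset.sum_sdiff hsub, add_sub_cancel_right]
  rw [norm_sub_rev, hdiff]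
  -- each term is bounded by the indicator of the window; sets meeting `t₀` through `q`
  have hterm : ∀ t ∈ P.powerset \ (P \ t₀).powerset, ‖f t‖ ≤
      if (∃ q ∈ t₀, q ∈ t) ∧ (∏ p ∈ t, p) ∈ Finset.Ioc ⌊y⌋₊ ⌊y * (1 + eta c₁ x)⌋₊ then 1 else 0 := by
    intro t ht
    rw [Finset.mem_sdiff, Finset.mem_powerset, Finset.mem_powerset, Finset.subset_sdiff, not_and] at ht
    obtain ⟨htP, hnot⟩ := ht
    have hmeet : ∃ q ∈ t₀, q ∈ t := by
      have := hnot htP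
      rw [Finset.disjoint_left] at this
      push Not at this
      obtain ⟨q, hq1, hq2⟩ := this
      exact ⟨q, hq2, hq1⟩
    simp only [hf]
    by_cases hw : win c₁ x y (∏ p ∈ t, ((p : ℕ) : ℝ))
    · rw [if_pos hw]
      have hI : (∏ p ∈ t, p) ∈ Finset.Ioc ⌊y⌋₊ ⌊y * (1 + eta c₁ x)⌋₊ := by
        rw [Finset.mem_Ioc, Nat.floor_lt hy0, Nat.le_floor_iff (by positivity)]
        push_cast
        exact hw
      rw [if_pos ⟨hmeet, hI⟩, norm_prod]
      exact Finset.prod_le_one (fun p _ => norm_nonneg _) fun p _ => (B.norm_wt_le x p).trans (by norm_num)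
    · rw [if_neg hw, norm_zero]; positivity
  refine (norm_sum_le _ _).trans ((Finset.sum_le_sum hterm).trans ?_)
  rw [Finset.sum_boole]
  -- count: at most `∑_{q ∈ t₀} #{multiples of q in the window}`
  have hcount : ((P.powerset \ (P \ t₀).powerset).filter (fun t => (∃ q ∈ t₀, q ∈ t) ∧
      (∏ p ∈ t, p) ∈ Finset.Ioc ⌊y⌋₊ ⌊y * (1 + eta c₁ x)⌋₊)).card ≤
      ∑ q ∈ t₀, ((Finset.Ioc ⌊y⌋₊ ⌊y * (1 + eta c₁ x)⌋₊).filter (fun m => q ∣ m)).card := by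
    calc ((P.powerset \ (P \ t₀).powerset).filter (fun t => (∃ q ∈ t₀, q ∈ t) ∧
          (∏ p ∈ t, p) ∈ Finset.Ioc ⌊y⌋₊ ⌊y * (1 + eta c₁ x)⌋₊)).card
        ≤ (t₀.biUnion fun q => P.powerset.filter (fun t => q ∈ t ∧
            (∏ p ∈ t, p) ∈ Finset.Ioc ⌊y⌋₊ ⌊y * (1 + eta c₁ x)⌋₊)).card := by
          refine Finset.card_le_card fun t ht => ?_
          rw [Finset.mem_filter, Finset.mem_sdiff] at ht
          obtain ⟨⟨htP, _⟩, ⟨q, hq, hqt⟩, hI⟩ := ht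
          exact Finset.mem_biUnion.mpr ⟨q, hq, Finset.mem_filter.mpr ⟨htP, hqt, hI⟩⟩
      _ ≤ ∑ q ∈ t₀, (P.powerset.filter (fun t => q ∈ t ∧
            (∏ p ∈ t, p) ∈ Finset.Ioc ⌊y⌋₊ ⌊y * (1 + eta c₁ x)⌋₊)).card := Finset.card_biUnion_le
      _ ≤ ∑ q ∈ t₀, ((Finset.Ioc ⌊y⌋₊ ⌊y * (1 + eta c₁ x)⌋₊).filter (fun m => q ∣ m)).card :=
          Finset.sum_le_sum fun q _ => card_powerset_filter_mem_le P (fun p hp => primesIn_prime hp) q _ _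
  have hfl : ⌊y⌋₊ ≤ ⌊y * (1 + eta c₁ x)⌋₊ := Nat.floor_le_floor hyy
  calc ((((P.powerset \ (P \ t₀).powerset).filter (fun t => (∃ q ∈ t₀, q ∈ t) ∧
          (∏ p ∈ t, p) ∈ Finset.Ioc ⌊y⌋₊ ⌊y * (1 + eta c₁ x)⌋₊)).card : ℕ) : ℝ)
      ≤ ∑ q ∈ t₀, (((Finset.Ioc ⌊y⌋₊ ⌊y * (1 + eta c₁ x)⌋₊).filter (fun m => q ∣ m)).card : ℝ) := by
        exact_mod_cast hcount
    _ ≤ ∑ q ∈ t₀, ((y * eta c₁ x + 1) / x ^ B.ε + 1) := by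
        refine Finset.sum_le_sum fun q hq => ?_
        have hqprime : q.Prime := Nat.prime_of_mem_primeFactors hq
        refine (card_multiples_Ioc_le _ _ _ hfl hqprime.pos).trans ?_
        have hnum : ((⌊y * (1 + eta c₁ x)⌋₊ : ℝ) - ⌊y⌋₊) ≤ y * eta c₁ x + 1 := by
          have h2 : (⌊y * (1 + eta c₁ x)⌋₊ : ℝ) ≤ y * (1 + eta c₁ x) := Nat.floor_le (by positivity)
          have h3 : y - 1 < (⌊y⌋₊ : ℝ) := by have := Nat.lt_floor_add_one y; linarith
          linarith
        have hq' : x ^ B.ε ≤ (q : ℝ) := hbig q hq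
        gcongr
    _ = (t₀.card : ℝ) * ((y * eta c₁ x + 1) / x ^ B.ε + 1) := by
        rw [Finset.sum_const, nsmul_eq_mul]

/-! ### The estimate for `S(y)` -/

/-- The shape of the Lemma 2.2 estimate for the weight `G` of the construction, as a hypothesis on
a family of constants `Cf r`. [folklore] -/
def LemmaC (Cf : ℕ → ℝ) (c₁ x : ℝ) : Prop :=
  ∀ r, 1 ≤ r → r ≤ B.M → ∀ y : ℝ, 0 < y → y ≤ 2 * x →
    ‖primeSum c₁ x B.G r y -
        ((y * eta c₁ x / Real.log x : ℝ) : ℂ) * B.G.cpow r (Real.log y / Real.log x)‖ ≤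
      Cf r * y * eta c₁ x ^ 2 / Real.log x

/-- **The subset sum is small**: for `1 ≤ y ≤ x` with `log y/log x > 1/M + w` (and `x` large),
`‖S(y)‖ ≤ ∑_{r=1}^{M} (C_r yη²/log x + r^r (2(yη+1)/x^ε + √(y(1+η)) + 1))` — layers `r = 1..M`
via injective tuples = all tuples (`Σ_r`, evaluated by Lemma 2.2, main terms cancelling by
`mainTerm_eq_zero`) minus the few non-injective ones. [cite: Ford2004, §3 (3.2)–(3.4)] -/
theorem norm_Ssum_le {c₁ x : ℝ} (hx : 1 < x) (hc₁ : 0 < c₁)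
    (hxbig : 4 * x < x ^ ((B.M + 1 : ℝ) * B.ε)) {Cf : ℕ → ℝ} (hCf : B.LemmaC Cf c₁ x)
    {y : ℝ} (hy1 : 1 ≤ y) (hyx : y ≤ x) (hY : 1 / B.M + B.w < Real.log y / Real.log x) :
    ‖SsumH B.G c₁ x y‖ ≤ ∑ r ∈ Icc 1 B.M, (Cf r * y * eta c₁ x ^ 2 / Real.log x +
      (r : ℝ) ^ r * ((y * eta c₁ x + 1) * (2 / x ^ B.ε) + (Real.sqrt (y * (1 + eta c₁ x)) + 1))) := by
  classical
  set P := primesIn 0 ⌊x ^ 2⌋₊ with hP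
  set η := eta c₁ x with hη
  set L := Real.log x with hL
  set Y := Real.log y / L with hYdef
  have hL0 : 0 < L := Real.log_pos hx
  have hy0 : 0 < y := by linarith
  have hY1 : Y ≤ 1 := by
    rw [hYdef, div_le_one hL0]; exact Real.log_le_log hy0 hyx
  rw [SsumH_eq_sum_primeSum_sub hx B.ε_pos B.G_vanish hc₁.le hxbig hy1 (by linarith)]
  -- insert the (vanishing) main terms
  set E : ℕ → ℂ := fun r => primeSum c₁ x B.G r y - ((y * η / L : ℝ) : ℂ) * B.G.cpow r Y with hE
  set N : ℕ → ℂ := fun r => ∑ u ∈ (Fintype.piFinset (fun _ : Fin r => P)).filter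
      (fun u => ¬ Function.Injective u),
      (if win c₁ x y (∏ i, ((u i : ℕ) : ℝ)) then ∏ i, B.wt x (u i) else 0) with hN
  have hmain : ∑ r ∈ Icc 1 B.M, ((r.factorial : ℂ)⁻¹) * (primeSum c₁ x B.G r y - N r) =
      ∑ r ∈ Icc 1 B.M, ((r.factorial : ℂ)⁻¹) * (E r - N r) := by
    have h1 : ∑ r ∈ Icc 1 B.M, ((r.factorial : ℂ)⁻¹) * (primeSum c₁ x B.G r y - N r) =
        ∑ r ∈ Icc 1 B.M, ((r.factorial : ℂ)⁻¹) * (E r - N r) +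
          ((y * η / L : ℝ) : ℂ) * ∑ r ∈ Icc 1 B.M, ((r.factorial : ℂ)⁻¹) * B.G.cpow r Y := by
      rw [Finset.mul_sum, ← Finset.sum_add_distrib]
      refine Finset.sum_congr rfl fun r _ => ?_
      simp only [hE]; ring
    rw [h1, B.mainTerm_eq_zero hY1 hY, mul_zero, add_zero]
  change ‖∑ r ∈ Icc 1 B.M, ((r.factorial : ℂ)⁻¹) * (primeSum c₁ x B.G r y - N r)‖ ≤ _
  rw [hmain]
  -- estimate
  refine (norm_sum_le _ _).trans (Finset.sum_le_sum fun r hr => ?_)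
  have hr1 : 1 ≤ r := (Finset.mem_Icc.mp hr).1
  have hrM : r ≤ B.M := (Finset.mem_Icc.mp hr).2
  have hfac : ‖((r.factorial : ℂ)⁻¹)‖ ≤ 1 := by
    rw [norm_inv, Complex.norm_natCast]
    exact inv_le_one_of_one_le₀ (by exact_mod_cast Nat.one_le_iff_ne_zero.mpr r.factorial_ne_zero)
  rw [norm_mul]
  refine (mul_le_mul hfac le_rfl (norm_nonneg _) zero_le_one).trans ?_
  rw [one_mul]
  refine (norm_sub_le _ _).trans (add_le_add ?_ ?_)
  · exact hCf r hr1 hrM y hy0 (by linarith)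
  · have h := norm_sum_nonInj_le (H := B.G) (W₀ := 1) (c₁ := c₁) hx B.ε_pos le_rfl
      (fun p => (B.norm_wt_le x p).trans (by norm_num)) B.G_vanish r hy0.le
    rw [one_pow, one_mul] at h
    exact h

/-! ### The Type-I estimate (2.4) -/

/-- Size of `log`: `x ≥ e^A` gives `log x ≥ A`. [folklore] -/
theorem le_log_of_exp_le {A x : ℝ} (h : Real.exp A ≤ x) : A ≤ Real.log x := by
  have := Real.log_le_log (Real.exp_pos A) h
  rwa [Real.log_exp] at this

/-- `η² x^ε ≥ 1` once `log x ≥ (2c₁/ε)²`. [folklore] -/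
theorem one_le_eta_sq_mul_rpow {c₁ ε x : ℝ} (hε : 0 < ε) (hx : 1 < x)
    (hL : (2 * c₁ / ε) ^ 2 ≤ Real.log x) : 1 ≤ eta c₁ x ^ 2 * x ^ ε := by
  have hx0 : 0 < x := by linarith
  set L := Real.log x
  have hL0 : 0 ≤ L := (Real.log_pos hx).le
  have hsq : 2 * c₁ / ε ≤ Real.sqrt L := Real.le_sqrt_of_sq_le hL
  rw [eta, ← Real.exp_nat_mul, Real.rpow_def_of_pos hx0, ← Real.exp_add]
  apply Real.one_le_exp
  push_cast
  have h1 : 2 * c₁ ≤ ε * Real.sqrt L := by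
    rw [div_le_iff₀ hε] at hsq; linarith
  have h2 : Real.sqrt L * Real.sqrt L = L := Real.mul_self_sqrt hL0
  nlinarith [Real.sqrt_nonneg L]

/-- The three largeness conditions on `x` used in the Type-I estimate. [folklore] -/
theorem thresholds {c₁ ϖ x : ℝ} (hϖ0 : 0 < ϖ) (hx1 : 1 < x)
    (hx1' : Real.exp ((2 * c₁ / B.ε) ^ 2) ≤ x) (hx2' : Real.exp ((4 * c₁ / ϖ) ^ 2) ≤ x)
    (hx3' : Real.exp (4 * B.M) ≤ x) :
    1 ≤ eta c₁ x ^ 2 * x ^ B.ε ∧ 1 ≤ eta c₁ x ^ 4 * x ^ ϖ ∧ 4 * x < x ^ ((B.M + 1 : ℝ) * B.ε) := by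
  have hε := B.ε_pos
  have hx0 : 0 < x := by linarith
  have hM0 := B.M_pos
  refine ⟨one_le_eta_sq_mul_rpow hε hx1 (le_log_of_exp_le hx1'), ?_, ?_⟩
  · have := one_le_eta_sq_mul_rpow (c₁ := 2 * c₁) (ε := ϖ) hϖ0 hx1 (by
      have := le_log_of_exp_le hx2'
      calc (2 * (2 * c₁) / ϖ) ^ 2 = (4 * c₁ / ϖ) ^ 2 := by ring
        _ ≤ Real.log x := this)
    have heq : eta (2 * c₁) x = eta c₁ x ^ 2 := by
      rw [eta, eta, ← Real.exp_nat_mul]; push_cast; ring_nf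
    rw [heq] at this
    calc (1 : ℝ) ≤ (eta c₁ x ^ 2) ^ 2 * x ^ ϖ := this
      _ = eta c₁ x ^ 4 * x ^ ϖ := by ring
  · have h1 := B.one_add_lt_succ_mul_ε
    have h2 : x ^ (1 + 1 / (2 * (B.M : ℝ))) < x ^ ((B.M + 1 : ℝ) * B.ε) :=
      Real.rpow_lt_rpow_of_exponent_lt hx1 h1
    refine lt_of_le_of_lt ?_ h2
    rw [Real.rpow_add hx0, Real.rpow_one]
    have h3 : (4 : ℝ) ≤ x ^ (1 / (2 * (B.M : ℝ))) := by
      have hlog := le_log_of_exp_le hx3'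
      rw [Real.rpow_def_of_pos hx0]
      have : Real.log 4 ≤ Real.log x * (1 / (2 * B.M)) := by
        rw [mul_one_div, le_div_iff₀ (by positivity)]
        have h4 : Real.log 4 ≤ 2 := by
          have : Real.log 4 = 2 * Real.log 2 := by
            rw [show (4 : ℝ) = 2 ^ 2 by norm_num, Real.log_pow]; norm_num
          rw [this]
          have := Real.log_two_lt_d9
          linarith
        nlinarith
      calc (4 : ℝ) = Real.exp (Real.log 4) := (Real.exp_log (by norm_num)).symm
        _ ≤ Real.exp (Real.log x * (1 / (2 * B.M))) := Real.exp_le_exp.mpr this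
    nlinarith

/-- Consequences for `y ≥ x^ϖ`: `1/x^ε ≤ η²`, `1 ≤ √y η²`, `1 ≤ y η²`. [folklore] -/
theorem y_facts {c₁ ϖ x y : ℝ} (hx0 : 0 < x) (hT1 : 1 ≤ eta c₁ x ^ 2 * x ^ B.ε)
    (hT2 : 1 ≤ eta c₁ x ^ 4 * x ^ ϖ) (hyϖ : x ^ ϖ ≤ y) (hy1 : 1 ≤ y) :
    1 / x ^ B.ε ≤ eta c₁ x ^ 2 ∧ 1 ≤ Real.sqrt y * eta c₁ x ^ 2 ∧ 1 ≤ y * eta c₁ x ^ 2 := by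
  set η := eta c₁ x with hη
  have hy0 : 0 < y := by linarith
  have hxε : 1 / x ^ B.ε ≤ η ^ 2 := by
    have hz : 0 < x ^ B.ε := Real.rpow_pos_of_pos hx0 _
    rw [div_le_iff₀ hz]; linarith
  have hsqrt : 1 ≤ Real.sqrt y * η ^ 2 := by
    have h1 : Real.sqrt (x ^ ϖ) ≤ Real.sqrt y := Real.sqrt_le_sqrt hyϖ
    have h2 : 1 ≤ Real.sqrt (x ^ ϖ) * η ^ 2 := by
      have h3 : Real.sqrt (η ^ 4 * x ^ ϖ) = η ^ 2 * Real.sqrt (x ^ ϖ) := by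
        rw [Real.sqrt_mul (by positivity), show η ^ 4 = (η ^ 2) ^ 2 by ring,
          Real.sqrt_sq (by positivity)]
      have := Real.sqrt_le_sqrt hT2
      rw [Real.sqrt_one, h3] at this
      linarith
    nlinarith [Real.sqrt_nonneg (x ^ ϖ), sq_nonneg η]
  refine ⟨hxε, hsqrt, ?_⟩
  have : Real.sqrt y ≤ y := by
    calc Real.sqrt y = Real.sqrt y * 1 := (mul_one _).symm
      _ ≤ Real.sqrt y * Real.sqrt y := by
          gcongr
          rw [show (1:ℝ) = Real.sqrt 1 by simp]; exact Real.sqrt_le_sqrt hy1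
      _ = y := Real.mul_self_sqrt hy0.le
  nlinarith [sq_nonneg η]

/-- The final bookkeeping of the Type-I estimate: every error term is `O(y η²)`. [folklore] -/
theorem final_arith {Cf : ℕ → ℝ} (hCf0 : ∀ r, 0 ≤ Cf r) {c₁ x y L T : ℝ}
    (hxε : 1 / x ^ B.ε ≤ eta c₁ x ^ 2) (hsqrt : 1 ≤ Real.sqrt y * eta c₁ x ^ 2)
    (hyη : 1 ≤ y * eta c₁ x ^ 2) (hy1 : 1 ≤ y) (hη1 : eta c₁ x ≤ 1) (hη0 : 0 < eta c₁ x)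
    (hL1 : 1 ≤ L) (hT : T ≤ 1 / B.ε) (hxpos : 0 < x ^ B.ε) :
    T * ((y * eta c₁ x + 1) / x ^ B.ε + 1) +
        ∑ r ∈ Icc 1 B.M, (Cf r * y * eta c₁ x ^ 2 / L +
          (r : ℝ) ^ r * ((y * eta c₁ x + 1) * (2 / x ^ B.ε) + (Real.sqrt (y * (1 + eta c₁ x)) + 1))) ≤
      (∑ r ∈ Icc 1 B.M, (Cf r + 7 * (r : ℝ) ^ r) + 3 / B.ε) * y * eta c₁ x ^ 2 := by
  set η := eta c₁ x with hη
  have hy0 : 0 < y := by linarith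
  have hε := B.ε_pos
  have h2y : y * η + 1 ≤ 2 * y := by nlinarith
  have hA : T * ((y * η + 1) / x ^ B.ε + 1) ≤ 3 / B.ε * (y * η ^ 2) := by
    have h1 : (y * η + 1) / x ^ B.ε + 1 ≤ 3 * (y * η ^ 2) := by
      have h3 : (y * η + 1) / x ^ B.ε ≤ 2 * y * η ^ 2 := by
        rw [div_eq_mul_one_div]
        calc (y * η + 1) * (1 / x ^ B.ε) ≤ (2 * y) * η ^ 2 :=
              mul_le_mul h2y hxε (by positivity) (by positivity)
          _ = 2 * y * η ^ 2 := by ring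
      linarith
    calc T * ((y * η + 1) / x ^ B.ε + 1) ≤ (1 / B.ε) * (3 * (y * η ^ 2)) :=
          mul_le_mul hT h1 (by positivity) (by positivity)
      _ = 3 / B.ε * (y * η ^ 2) := by ring
  have hB : ∀ r ∈ Icc 1 B.M, Cf r * y * η ^ 2 / L +
      (r : ℝ) ^ r * ((y * η + 1) * (2 / x ^ B.ε) + (Real.sqrt (y * (1 + η)) + 1)) ≤
      (Cf r + 7 * (r : ℝ) ^ r) * (y * η ^ 2) := by
    intro r _
    have h1 : Cf r * y * η ^ 2 / L ≤ Cf r * (y * η ^ 2) := by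
      rw [mul_assoc]
      exact div_le_self (by have := hCf0 r; positivity) hL1
    have h2 : (y * η + 1) * (2 / x ^ B.ε) ≤ 4 * (y * η ^ 2) := by
      calc (y * η + 1) * (2 / x ^ B.ε) = (y * η + 1) * (1 / x ^ B.ε) * 2 := by ring
        _ ≤ (2 * y) * η ^ 2 * 2 := by gcongr
        _ = 4 * (y * η ^ 2) := by ring
    have h3 : Real.sqrt (y * (1 + η)) + 1 ≤ 3 * (y * η ^ 2) := by
      have h4 : Real.sqrt (y * (1 + η)) ≤ 2 * Real.sqrt y := by
        rw [show 2 * Real.sqrt y = Real.sqrt (2 ^ 2 * y) by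
          rw [Real.sqrt_mul (by norm_num), Real.sqrt_sq (by norm_num)]]
        exact Real.sqrt_le_sqrt (by nlinarith)
      have h5 : Real.sqrt y ≤ y * η ^ 2 := by
        calc Real.sqrt y = Real.sqrt y * 1 := (mul_one _).symm
          _ ≤ Real.sqrt y * (Real.sqrt y * η ^ 2) := by gcongr
          _ = y * η ^ 2 := by rw [← mul_assoc, Real.mul_self_sqrt hy0.le]
      linarith
    have hr0 : (0 : ℝ) ≤ (r : ℝ) ^ r := by positivity
    nlinarith
  calc T * ((y * η + 1) / x ^ B.ε + 1) +
        ∑ r ∈ Icc 1 B.M, (Cf r * y * η ^ 2 / L +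
          (r : ℝ) ^ r * ((y * η + 1) * (2 / x ^ B.ε) + (Real.sqrt (y * (1 + η)) + 1)))
      ≤ 3 / B.ε * (y * η ^ 2) + ∑ r ∈ Icc 1 B.M, (Cf r + 7 * (r : ℝ) ^ r) * (y * η ^ 2) :=
        add_le_add hA (Finset.sum_le_sum hB)
    _ = (∑ r ∈ Icc 1 B.M, (Cf r + 7 * (r : ℝ) ^ r) + 3 / B.ε) * y * η ^ 2 := by
        rw [← Finset.sum_mul]; ring

/-- `|t₀| ≤ 1/ε` when all primes of `d ≤ x` are `≥ x^ε`. [folklore] -/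
theorem card_primeFactors_le {x : ℝ} (hx1 : 1 < x) {d : ℕ} (hd1 : 1 ≤ d) (hdx : (d : ℝ) ≤ x)
    (hbig : ∀ q ∈ d.primeFactors, x ^ B.ε ≤ (q : ℝ)) :
    (d.primeFactors.card : ℝ) ≤ 1 / B.ε := by
  have hx0 : 0 < x := by linarith
  have hε := B.ε_pos
  set t₀ := d.primeFactors
  have h1 : (x ^ B.ε) ^ t₀.card ≤ (d : ℝ) := by
    have h2 : ∏ _q ∈ t₀, (x ^ B.ε) ≤ ∏ q ∈ t₀, (q : ℝ) :=
      Finset.prod_le_prod (fun q _ => by positivity) fun q hq => hbig q hq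
    rw [Finset.prod_const] at h2
    refine h2.trans ?_
    have h3 : ∏ q ∈ t₀, q ∣ d := Nat.prod_primeFactors_dvd d
    have h3' := Nat.le_of_dvd hd1 h3
    calc ∏ q ∈ t₀, (q : ℝ) = ((∏ q ∈ t₀, q : ℕ) : ℝ) := (Nat.cast_prod _ _).symm
      _ ≤ d := by exact_mod_cast h3'
  have h4 : (x ^ B.ε) ^ t₀.card = x ^ (B.ε * t₀.card) := by
    rw [← Real.rpow_natCast, ← Real.rpow_mul hx0.le]
  rw [h4] at h1
  have h5 : B.ε * t₀.card * Real.log x ≤ Real.log x := by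
    have := Real.log_le_log (Real.rpow_pos_of_pos hx0 _) (h1.trans hdx)
    rwa [Real.log_rpow hx0] at this
  have hL : 0 < Real.log x := Real.log_pos hx1
  rw [le_div_iff₀ hε]
  nlinarith

/-- **Type-I estimate** ([Ford2004] (2.4) for the perturbation, via (3.2)–(3.4)): for the data
`B`, the constants `c, C` of the prime number theorem, `c₁ ≤ c√ε/4` and a level exponent `ϖ`
with `1/M + w < ϖ ≤ 1`, there are `C_A, x₀` such that for `x ≥ x₀` and `1 ≤ d ≤ x^{1−ϖ}`,
`‖∑_{x < n ≤ x+xη, d ∣ n} B(n)‖ ≤ C_A (x/d) η²`. [cite: Ford2004, §3 (3.2)–(3.4) and (2.4)] -/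
theorem typeI_bound {c C : ℝ} (hc : 0 < c)
    (hPNT : ∀ u : ℝ, 2 ≤ u → |θ u - u| ≤ C * u / Real.exp (c * Real.sqrt (Real.log u)))
    {c₁ : ℝ} (hc₁ : 0 < c₁) (hc₁' : c₁ ≤ c * Real.sqrt B.ε / 4)
    {ϖ : ℝ} (hϖ : 1 / B.M + B.w < ϖ) :
    ∃ CA x₀ : ℝ, ∀ x : ℝ, x₀ ≤ x → ∀ d : ℕ, 1 ≤ d → (d : ℝ) ≤ x ^ (1 - ϖ) →
      ‖B.Tsum c₁ x d‖ ≤ CA * (x / d) * eta c₁ x ^ 2 := by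
  classical
  have hε := B.ε_pos
  have hε1 := B.ε_le_one
  have hM0 := B.M_pos
  have hϖ0 : 0 < ϖ := lt_trans (by have := B.w_pos; positivity) hϖ
  -- the constants of Lemma 2.2 for `r = 1, …, M`
  have hS0 : (0 : ℝ) ≤ 1 / 4 := by norm_num
  have hK0 : 0 ≤ B.M * B.K := mul_nonneg hM0.le (nonneg_of_lip B.lip)
  have key : ∀ r : ℕ, ∃ C₀ : ℝ, 0 ≤ C₀ ∧ (1 ≤ r → ∀ x : ℝ, xThreshold B.ε ≤ x →
      ∀ y : ℝ, 0 < y → y ≤ 2 * x →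
        ‖primeSum c₁ x B.G r y -
            ((y * eta c₁ x / Real.log x : ℝ) : ℂ) * B.G.cpow r (Real.log y / Real.log x)‖ ≤
          C₀ * y * eta c₁ x ^ 2 / Real.log x) := by
    intro r
    rcases Nat.eq_zero_or_pos r with rfl | hr
    · exact ⟨0, le_rfl, fun h => absurd h (by norm_num)⟩
    · obtain ⟨C₀, hC₀, h⟩ := primeSum_est hc hPNT hε hε1 hS0 hK0 (r := r) hr
      exact ⟨C₀, hC₀, fun _ x hx y hy hyx =>
        h x hx c₁ hc₁ hc₁' B.G B.norm_G_le B.norm_G_sub_le B.suppIn_G y hy hyx⟩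
  choose Cf hCf0 hCf using key
  refine ⟨∑ r ∈ Icc 1 B.M, (Cf r + 7 * (r : ℝ) ^ r) + 3 / B.ε,
    max (xThreshold B.ε) (max (Real.exp ((2 * c₁ / B.ε) ^ 2))
      (max (Real.exp ((4 * c₁ / ϖ) ^ 2)) (Real.exp (4 * B.M)))), fun x hx d hd1 hdx => ?_⟩
  rw [max_le_iff, max_le_iff, max_le_iff] at hx
  obtain ⟨hxT, hx1', hx2', hx3'⟩ := hx
  obtain ⟨hxe, _, hx16⟩ := xThreshold_spec hε hε1 hxT
  have hx1 : 1 < x := by linarith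
  have hx0 : 0 < x := by linarith
  have hL1 : 1 ≤ Real.log x := by
    rw [← Real.log_exp 1]; exact Real.log_le_log (Real.exp_pos 1) hxe
  have hL0 : 0 < Real.log x := by linarith
  have hη0 : 0 < eta c₁ x := eta_pos c₁ x
  have hη1 : eta c₁ x ≤ 1 := eta_le_one hc₁.le x
  have hd0 : (0 : ℝ) < d := by exact_mod_cast hd1
  have hdx1 : (d : ℝ) ≤ x := hdx.trans (by
    calc x ^ (1 - ϖ) ≤ x ^ (1 : ℝ) := Real.rpow_le_rpow_of_exponent_le hx1.le (by linarith)
      _ = x := Real.rpow_one x)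
  have hyϖ : x ^ ϖ ≤ x / d := by
    rw [le_div_iff₀ hd0]
    calc x ^ ϖ * d ≤ x ^ ϖ * x ^ (1 - ϖ) := by gcongr
      _ = x := by rw [← Real.rpow_add hx0]; norm_num
  have hy1 : 1 ≤ x / d := le_trans (Real.one_le_rpow hx1.le hϖ0.le) hyϖ
  have hyx : x / d ≤ x := div_le_self hx0.le (by exact_mod_cast hd1)
  have hy0 : 0 < x / d := by linarith
  -- thresholds and their consequences
  obtain ⟨hT1, hT2, hT3⟩ := B.thresholds hϖ0 hx1 hx1' hx2' hx3'
  obtain ⟨hxε, hsqrt, hyη⟩ := B.y_facts hx0 hT1 hT2 hyϖ hy1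
  have hY : 1 / B.M + B.w < Real.log (x / d) / Real.log x := by
    refine lt_of_lt_of_le hϖ ?_
    rw [le_div_iff₀ hL0]
    have := Real.log_le_log (Real.rpow_pos_of_pos hx0 ϖ) hyϖ
    rwa [Real.log_rpow hx0] at this
  -- Lemma C package and the subset-sum estimate
  have hLC : B.LemmaC Cf c₁ x := fun r hr1 hrM y' hy' hyx' => hCf r hr1 x hxT y' hy' hyx'
  have hSsum := B.norm_Ssum_le hx1 hc₁ hT3 hLC hy1 hyx hY
  -- the factorisation of `T(d)`
  have hCA : 0 ≤ (∑ r ∈ Icc 1 B.M, (Cf r + 7 * (r : ℝ) ^ r) + 3 / B.ε) * (x / d) * eta c₁ x ^ 2 := by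
    refine mul_nonneg (mul_nonneg (add_nonneg (Finset.sum_nonneg fun r _ => ?_) (by positivity))
      hy0.le) (by positivity)
    have := hCf0 r; positivity
  rw [B.Tsum_eq hx0.le hd1]
  split_ifs with hcond
  swap
  · rw [norm_zero]; exact hCA
  by_cases hsmall : ∃ q ∈ d.primeFactors, (q : ℝ) < x ^ B.ε
  · obtain ⟨q, hq, hqx⟩ := hsmall
    rw [Finset.prod_eq_zero hq (B.wt_eq_zero_of_lt hx1 hqx), zero_mul, norm_zero]
    exact hCA
  push Not at hsmall
  have ht₀card := B.card_primeFactors_le hx1 hd1 hdx1 hsmall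
  have hinner := B.norm_innerSum_sub_Ssum_le (c₁ := c₁) hx1 hd1 hsmall
  have hwt : ‖∏ p ∈ d.primeFactors, B.wt x p‖ ≤ 1 := by
    rw [norm_prod]
    exact Finset.prod_le_one (fun p _ => norm_nonneg _) fun p _ => (B.norm_wt_le x p).trans (by norm_num)
  rw [norm_mul]
  refine (mul_le_mul hwt le_rfl (norm_nonneg _) zero_le_one).trans ?_
  rw [one_mul]
  have hsplit : ‖B.innerSum c₁ x d‖ ≤ ‖B.innerSum c₁ x d - SsumH B.G c₁ x (x / d)‖ +
      ‖SsumH B.G c₁ x (x / d)‖ := by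
    have := norm_add_le (B.innerSum c₁ x d - SsumH B.G c₁ x (x / d)) (SsumH B.G c₁ x (x / d))
    rwa [sub_add_cancel] at this
  refine hsplit.trans ((add_le_add hinner hSsum).trans ?_)
  have := B.final_arith hCf0 hxε hsqrt hyη hy1 hη1 hη0 hL1 ht₀card
    (Real.rpow_pos_of_pos hx0 _)
  refine this.trans (le_of_eq ?_)
  ring

end Bump

end Literature.NumberTheory.Sieve.Ford2004
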